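import Literature.AlgebraicGeometry.Modules.CechSectionsCochainDictionary
import Literature.Algebra.Homology.OrderedCechSystemFullResCup
import Literature.Algebra.Homology.OrderedCechSystemFullRefine
import Literature.Algebra.Homology.OrderedCechSystemCupClasses
import HarnessLib

/-!
# Refinement maps along arbitrary index maps are multiplicative on ordered Čech cohomology classes
# (The Stacks Project, Tags 01FG, 01FM, 01FP; Görtz–Wedhorn II (21.29))

Topic `AlgebraicGeometry/Modules`; namespaces `Literature.Algebra.Homology.OrderedCech.Full` (§0–§1, pure algebra) and
`Literature.AlgebraicGeometry.Modules` (§2–§3).  PROOF file (theorems only; no definition, no named fact, no instance, no notation,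
no `sorry`).  Cell `hodgecm-mathlib` FLOOR 0, P1 sub-line F-11, packet (iv)∕J3, brick **(G1-a)** (F0P1b-plan (g0) (R66)∕(R67);
F0P1b-p01 (g0)); consumers F-J3b (F0P1b-p02), (iv-4) (F0P1b-p04), (G1) (B-p10).

For an index map `θ : ι′ → ι` and comparisons `φ_M : θ(·)^*M ⟶ M′` (etc.) intertwining natural pairings `β : M × N → P`,
`β′ : M′ × N′ → P′`, the ordered refinement ★ `refineCochain θ φ` (alternating evaluation at the NON-monotone tuples
`θ ∘ e_{σ′}`) is NOT multiplicative for the ordered (front∕back) cup product on cochains, but it is on COHOMOLOGY: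

* §0 `homologyπ_eq_of_sub_eq_d` — two cocycles of a complex of modules differing by a coboundary have the same class
  (elementwise; Mathlib's `liftCycles_homologyπ_eq_zero_of_boundary` evaluated on the free module of rank one);
* §1 (pure algebra, any coefficient systems) `Full.res_cupDefect`, `Full.d_cupDefect`, `Full.refineCochain_cup_sub` — with
  `z := ext a ∪_F ext b − ext (a ∪ b) ∈ Full.Cochain P n` (★ `Full.cup`, ★ `Full.ext`) for ordered cocycles `a, b`:
  `res z = 0`, `d z = 0`, and `θ^♯(a ∪ b) − θ^♯a ∪ θ^♯b = − res′ (Θ_θ z)` (★ `Full.res_pullbackCochain_ext` = «`θ^♯ = res ∘ Θ ∘ ext`»,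
  ★ `Full.pullbackCochain_cup`, ★ `Full.res_cup`, ★ `Full.d_cup`, ★ `Full.d_ext`, ★ `Full.sysD_res`); in degree `0`, `z = 0`
  (`Full.eq_zero_of_res_eq_zero`);
* §2 `refineCochain_cup_sub_eq_sysD` — for `P = Modules.sectionsSystem 𝓤 L ρ` (finite cover with affine finite intersections,
  `L` affine-localizing) the defect is an ordered COBOUNDARY (★ `Full.exists_d_eq_of_res_eq_sysD`, i.e. Leray on both sides);
* §3 **`homologyMap_cupH`** — for cochain maps `F, G, K` of the ordered complexes with components `refineCochain θ φ_•`: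
  `Hⁿ(K)(x ⌣ y) = Hᵖ(F)x ⌣ Hᵠ(G)y` for p02's class-level cup ★ `OrderedCech.cupH` (all `p + q = n`).

## References
* The Stacks Project, Tags 01FG, 01FM (full vs ordered Čech complex), 01FP (cup product). [StacksProject]
* U. Görtz, T. Wedhorn, *Algebraic Geometry II* (2023), (21.29), Thm. 22.9 (p. 236). [GortzWedhorn2023]
* R. Godement, *Topologie algébrique et théorie des faisceaux* (1958), II §6.6. [Godement1958]
-/

universe v u

open CategoryTheory CategoryTheory.Limits HomologicalComplex AlgebraicGeometry TopologicalSpace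

set_option backward.isDefEq.respectTransparency false -- `ModuleCat`-valued functors (as in ★ `OrderedCechSystem`)

noncomputable section

namespace Literature.Algebra.Homology

/-! ## §0 Classes of cocycles differing by a coboundary -/

/-- **Two cocycles of a cochain complex of modules which differ by a coboundary have the same cohomology class**
(elementwise form of `liftCycles_homologyπ_eq_zero_of_boundary`, tested against the free module of rank one).
[cite: Godement1958, II §6.6] -/
theorem homologyπ_eq_of_sub_eq_d {A : Type u} [CommRing A] (K : CochainComplex (ModuleCat.{u} A) ℤ) {i i' : ℤ}
    (z z' : K.cycles i) (y : K.X i') (h : (K.iCycles i).hom z - (K.iCycles i).hom z' = (K.d i' i).hom y) :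
    (K.homologyπ i).hom z = (K.homologyπ i).hom z' := by
  let k : ModuleCat.of A A ⟶ K.X i := ModuleCat.ofHom (LinearMap.toSpanSingleton A _ ((K.iCycles i).hom (z - z')))
  let x : ModuleCat.of A A ⟶ K.X i' := ModuleCat.ofHom (LinearMap.toSpanSingleton A _ y)
  have hkx : k = x ≫ K.d i' i := by
    apply ModuleCat.hom_ext
    apply LinearMap.ext
    intro r
    change r • (K.iCycles i).hom (z - z') = (K.d i' i).hom (r • y)
    rw [map_smul, map_sub, h]
  have hk0 : k ≫ K.d i (i + 1) = 0 := by rw [hkx, Category.assoc, K.d_comp_d, comp_zero]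
  have hlift : K.liftCycles k (i + 1) (by simp) hk0 = ModuleCat.ofHom (LinearMap.toSpanSingleton A _ (z - z')) := by
    rw [← cancel_mono (K.iCycles i), HomologicalComplex.liftCycles_i]
    apply ModuleCat.hom_ext
    apply LinearMap.ext
    intro r
    change r • (K.iCycles i).hom (z - z') = (K.iCycles i).hom (r • (z - z'))
    rw [map_smul]
  have hπ := K.liftCycles_homologyπ_eq_zero_of_boundary k (i + 1) (by simp) x hkx
  rw [hlift] at hπ
  have h1 := congrArg (fun f : ModuleCat.of A A ⟶ K.homology i => f.hom (1 : A)) hπ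
  change (K.homologyπ i).hom ((1 : A) • (z - z')) = 0 at h1
  rwa [one_smul, map_sub, sub_eq_zero] at h1

namespace OrderedCech

namespace Full

variable {ι : Type} [LinearOrder ι] {A : Type u} [CommRing A]

/-! ## §1 The cup defect of the alternating extension (pure algebra) -/

section Algebra

variable {M N P : Finset ι ⥤ ModuleCat.{v} A} (β : ∀ s : Finset ι, M.obj s →ₗ[A] N.obj s →ₗ[A] P.obj s)

/-- **In degree `0` the restriction to increasing tuples is injective on full cochains** (every `1`-tuple is the sorted
enumeration of its singleton). [cite: StacksProject, Tag 01FG] -/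
theorem eq_zero_of_res_eq_zero (c : Cochain P 0) (hc : res P 0 c = 0) : c = 0 := by
  classical
  funext α
  let σ : Simplex ι ((0 : ℕ) : ℤ) := ⟨{α 0}, Finset.singleton_nonempty _, by simp⟩
  have hσ := congr_fun hc σ
  rw [res_apply] at hσ
  change (P.map (homOfLE _)).hom (c ⇑(σ.1.orderEmbOfFin (card_simplex 0 σ))) = 0 at hσ
  -- the enumeration of `{α 0}` is `α`
  have he : (⇑(σ.1.orderEmbOfFin (card_simplex 0 σ)) : Fin 1 → ι) = α := by
    funext i
    have hi : i = 0 := Fin.eq_zero i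
    subst hi
    have hmem : (σ.1.orderEmbOfFin (card_simplex 0 σ)) 0 ∈ ({α 0} : Finset ι) := Finset.orderEmbOfFin_mem _ _ 0
    exact Finset.mem_singleton.1 hmem
  -- transport along `he`
  have key : ∀ (e : Fin 1 → ι) (hle : Finset.univ.image e ⊆ σ.1) (_ : e = α),
      (P.map (homOfLE hle)).hom (c e) = 0 → c α = 0 := by
    intro e hle heα hz
    subst heα
    have hle' : σ.1 ⊆ Finset.univ.image e := by
      intro j hj
      have : j = e 0 := Finset.mem_singleton.1 hj
      subst this
      exact Finset.mem_image_of_mem e (Finset.mem_univ 0)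
    have := congrArg (fun t => (P.map (homOfLE hle')).hom t) hz
    rw [map_zero, map_map_apply] at this
    rwa [map_congr_apply P c rfl] at this
  exact key _ (image_orderEmbOfFin_simplex 0 σ).le he hσ

variable {β}

/-- `res (ext a ∪_F ext b − ext (a ∪ b)) = 0`: the position cup of the alternating extensions restricts to the ordered cup.
[cite: StacksProject, Tag 01FP] [cite: GortzWedhorn2023, (21.29)] -/
theorem res_cupDefect (hβ : IsNaturalPairing β) {p q n : ℕ} (h : p + q = n) (a : SysCochain M p) (b : SysCochain N q) :
    res P n (cup β p q n h (ext M p a) (ext N q b) - ext P n (OrderedCech.cup β p q n a b)) = 0 := by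
  rw [map_sub, res_cup β hβ h, res_ext, res_ext, res_ext, sub_self]

/-- The ordered cup of two cocycles is a cocycle (through the full complex: `a ∪ b = res (ext a ∪_F ext b)` and Leibniz there).
[cite: StacksProject, Tag 01FP] [cite: GortzWedhorn2023, (21.29)] -/
theorem sysD_cup_eq_zero (hβ : IsNaturalPairing β) {p q n : ℕ} (h : p + q = n) (a : SysCochain M p) (b : SysCochain N q)
    (ha : sysD M p a = 0) (hb : sysD N q b = 0) : sysD P n (OrderedCech.cup β p q n a b) = 0 := by
  have hab : OrderedCech.cup β p q n a b = res P n (cup β p q n h (ext M p a) (ext N q b)) := by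
    rw [res_cup β hβ h, res_ext, res_ext]
  have h1 : ((complex M).d p (p + 1)).hom (ext M p a) = 0 := by rw [d_ext, ha, map_zero]
  have h2 : ((complex N).d q (q + 1)).hom (ext N q b) = 0 := by rw [d_ext, hb, map_zero]
  rw [hab, sysD_res, d_cup β hβ p q n h, h1, h2, LinearMap.map_zero₂, LinearMap.map_zero, smul_zero, add_zero, map_zero]

/-- `d (ext a ∪_F ext b − ext (a ∪ b)) = 0` for cocycles `a`, `b`. [cite: StacksProject, Tag 01FP] [cite: GortzWedhorn2023, (21.29)] -/
theorem d_cupDefect (hβ : IsNaturalPairing β) {p q n : ℕ} (h : p + q = n) (a : SysCochain M p) (b : SysCochain N q)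
    (ha : sysD M p a = 0) (hb : sysD N q b = 0) :
    ((complex P).d n (n + 1)).hom (cup β p q n h (ext M p a) (ext N q b) - ext P n (OrderedCech.cup β p q n a b)) = 0 := by
  have h1 : ((complex M).d p (p + 1)).hom (ext M p a) = 0 := by rw [d_ext, ha, map_zero]
  have h2 : ((complex N).d q (q + 1)).hom (ext N q b) = 0 := by rw [d_ext, hb, map_zero]
  have h3 : ((complex P).d n (n + 1)).hom (ext P n (OrderedCech.cup β p q n a b)) = 0 := by
    rw [d_ext, sysD_cup_eq_zero hβ h a b ha hb, map_zero]
  rw [map_sub, h3, sub_zero, d_cup β hβ p q n h, h1, h2, LinearMap.map_zero₂, LinearMap.map_zero, smul_zero, add_zero]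

variable {ι' : Type} [LinearOrder ι'] {M' N' P' : Finset ι' ⥤ ModuleCat.{v} A}
  (β' : ∀ s' : Finset ι', M'.obj s' →ₗ[A] N'.obj s' →ₗ[A] P'.obj s') (θ : ι' → ι)
  (φM : imageFunctor θ ⋙ M ⟶ M') (φN : imageFunctor θ ⋙ N ⟶ N') (φP : imageFunctor θ ⋙ P ⟶ P')

/-- **The cup defect of a refinement on cochains**: `θ^♯(a ∪ b) − θ^♯a ∪ θ^♯b = − res′ (Θ_θ (ext a ∪_F ext b − ext (a ∪ b)))`
for every index map `θ` and comparisons `φ` intertwining the natural pairings `β`, `β′`.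
[cite: StacksProject, Tag 01FP] [cite: StacksProject, Tag 01FG] -/
theorem refineCochain_cup_sub (hβ : IsNaturalPairing β) (hβ' : IsNaturalPairing β')
    (hφ : ∀ (s' : Finset ι') (x : M.obj (s'.image θ)) (y : N.obj (s'.image θ)),
      (φP.app s').hom (β (s'.image θ) x y) = β' s' ((φM.app s').hom x) ((φN.app s').hom y))
    {p q n : ℕ} (h : p + q = n) (a : SysCochain M p) (b : SysCochain N q) :
    refineCochain θ φP n (OrderedCech.cup β p q n a b) -
        OrderedCech.cup β' p q n (refineCochain θ φM p a) (refineCochain θ φN q b) =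
      - res P' n (pullbackCochain θ φP n (cup β p q n h (ext M p a) (ext N q b) - ext P n (OrderedCech.cup β p q n a b))) := by
  rw [← res_pullbackCochain_ext θ φP, ← res_pullbackCochain_ext θ φM, ← res_pullbackCochain_ext θ φN,
    ← res_cup β' hβ' h, ← pullbackCochain_cup β β' θ φM φN φP hβ hφ h, map_sub, map_sub, neg_sub]

/-- In degree `0` the refinement IS multiplicative on cochains. [cite: StacksProject, Tag 01FP] -/
theorem refineCochain_cup_zero (hβ : IsNaturalPairing β) (hβ' : IsNaturalPairing β')
    (hφ : ∀ (s' : Finset ι') (x : M.obj (s'.image θ)) (y : N.obj (s'.image θ)),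
      (φP.app s').hom (β (s'.image θ) x y) = β' s' ((φM.app s').hom x) ((φN.app s').hom y))
    (a : SysCochain M (0 : ℕ)) (b : SysCochain N (0 : ℕ)) :
    refineCochain θ φP (0 : ℕ) (OrderedCech.cup β (0 : ℕ) (0 : ℕ) (0 : ℕ) a b) =
      OrderedCech.cup β' (0 : ℕ) (0 : ℕ) (0 : ℕ) (refineCochain θ φM (0 : ℕ) a) (refineCochain θ φN (0 : ℕ) b) := by
  have h0 := refineCochain_cup_sub β' θ φM φN φP hβ hβ' hφ (p := 0) (q := 0) (n := 0) rfl a b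
  rw [eq_zero_of_res_eq_zero _ (res_cupDefect hβ (p := 0) (q := 0) (n := 0) rfl a b), map_zero, map_zero, neg_zero,
    sub_eq_zero] at h0
  exact h0

/-- **Modulo Leray**: if the cup defect `ext a ∪_F ext b − ext (a ∪ b)` is a full coboundary `d w`, then
`θ^♯(a ∪ b) − θ^♯a ∪ θ^♯b = d (− res′ (Θ_θ w))` is an ordered coboundary. [cite: StacksProject, Tag 01FP] [cite: StacksProject, Tag 01FM] -/
theorem refineCochain_cup_sub_eq_sysD_of (hβ : IsNaturalPairing β) (hβ' : IsNaturalPairing β')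
    (hφ : ∀ (s' : Finset ι') (x : M.obj (s'.image θ)) (y : N.obj (s'.image θ)),
      (φP.app s').hom (β (s'.image θ) x y) = β' s' ((φM.app s').hom x) ((φN.app s').hom y))
    {p q m : ℕ} (h : p + q = m + 1) (a : SysCochain M p) (b : SysCochain N q) (w : Cochain P m)
    (hw : ((complex P).d m (m + 1)).hom w =
      cup β p q (m + 1) h (ext M p a) (ext N q b) - ext P (m + 1) (OrderedCech.cup β p q ((m + 1 : ℕ) : ℤ) a b)) :
    refineCochain θ φP ((m + 1 : ℕ) : ℤ) (OrderedCech.cup β p q ((m + 1 : ℕ) : ℤ) a b) -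
        OrderedCech.cup β' p q ((m + 1 : ℕ) : ℤ) (refineCochain θ φM p a) (refineCochain θ φN q b) =
      sysD P' m (- res P' m (pullbackCochain θ φP m w)) := by
  rw [refineCochain_cup_sub β' θ φM φN φP hβ hβ' hφ h, ← hw, map_neg, sysD_res]
  congr 2
  have hc := (pullback θ φP).comm m (m + 1)
  rw [pullback_f, pullback_f] at hc
  exact (congrArg (fun f => f.hom w) hc).symm

end Algebra

end Full

end OrderedCech

end Literature.Algebra.Homology

/-! ## §2 The cup defect is a coboundary for systems of sections (Leray) -/

namespace Literature.AlgebraicGeometry.Modules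

open Literature.Algebra.Homology Literature.Algebra.Homology.OrderedCech CategoryTheory.MonoidalCategory
open scoped TensorProduct

variable {X : Scheme.{0}} {ι : Type} [LinearOrder ι] [Fintype ι] (U : ι → X.Opens) (L : X.Modules)
  {A : Type} [CommRing A] (ρ : A →+* Γ(X, ⊤))
  {M N : Finset ι ⥤ ModuleCat.{0} A} (β : ∀ s : Finset ι, M.obj s →ₗ[A] N.obj s →ₗ[A] (sectionsSystem U L ρ).obj s)
  {ι' : Type} [LinearOrder ι'] {M' N' P' : Finset ι' ⥤ ModuleCat.{0} A}
  (β' : ∀ s' : Finset ι', M'.obj s' →ₗ[A] N'.obj s' →ₗ[A] P'.obj s') (θ : ι' → ι)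
  (φM : imageFunctor θ ⋙ M ⟶ M') (φN : imageFunctor θ ⋙ N ⟶ N') (φP : imageFunctor θ ⋙ sectionsSystem U L ρ ⟶ P')

/-- **The cup defect of a refinement is an ordered coboundary** when the target system is the system of sections
`(Γ(L, U_s))_s` of an affine-localizing `𝒪_X`-module on a finite cover with affine finite intersections: for ordered cocycles
`a`, `b` with `p + q = n`, `θ^♯(a ∪ b) − θ^♯a ∪ θ^♯b ∈ Im d` — precisely: it is `0` for `n = 0` and `sysD _ (n-1) η` otherwise.
[cite: StacksProject, Tag 01FM] [cite: StacksProject, Tag 01FP] [cite: GortzWedhorn2023, Thm. 22.9 (p. 236)] -/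
theorem refineCochain_cup_sub_eq_sysD (hUa : ∀ s : Finset ι, s.Nonempty → IsAffineOpen (cechOpen U s))
    (hcov : ⨆ i, U i = ⊤) (hL : IsAffineLocalizing L) (hβ : IsNaturalPairing β) (hβ' : IsNaturalPairing β')
    (hφ : ∀ (s' : Finset ι') (x : M.obj (s'.image θ)) (y : N.obj (s'.image θ)),
      (φP.app s').hom (β (s'.image θ) x y) = β' s' ((φM.app s').hom x) ((φN.app s').hom y))
    {p q m : ℕ} (h : p + q = m + 1) (a : SysCochain M p) (b : SysCochain N q)
    (ha : sysD M p a = 0) (hb : sysD N q b = 0) :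
    ∃ η : SysCochain P' m,
      refineCochain θ φP ((m + 1 : ℕ) : ℤ) (OrderedCech.cup β p q ((m + 1 : ℕ) : ℤ) a b) -
          OrderedCech.cup β' p q ((m + 1 : ℕ) : ℤ) (refineCochain θ φM p a) (refineCochain θ φN q b) = sysD P' m η := by
  obtain ⟨w, hw⟩ := Full.exists_d_eq_of_res_eq_sysD U L ρ hUa hcov hL m
    (Full.cup β p q (m + 1) h (Full.ext M p a) (Full.ext N q b) - Full.ext _ (m + 1) (OrderedCech.cup β p q ((m + 1 : ℕ) : ℤ) a b))
    (Full.d_cupDefect hβ h a b ha hb) 0 (by rw [Full.res_cupDefect hβ h a b, map_zero])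
  exact ⟨_, Full.refineCochain_cup_sub_eq_sysD_of β' θ φM φN φP hβ hβ' hφ h a b w hw⟩

/-! ## §3 On classes -/

/-- **Refinements along arbitrary index maps are multiplicative on ordered Čech cohomology classes.**  Let `𝓤` be a finite cover of
the scheme `X` with affine finite intersections, `L` an affine-localizing `𝒪_X`-module, `S := (Γ(L, U_s))_s` its system of sections,
`β : M × N → S` and `β′ : M′ × N′ → P′` natural pairings of coefficient systems on `ι`, `ι′`, `θ : ι′ → ι` any map and `φ_M, φ_N, φ_P`
comparisons over `θ` intertwining `β` and `β′`.  For cochain maps `F : Č(M) → Č(M′)`, `G : Č(N) → Č(N′)`, `K : Č(S) → Č(P′)` of the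
ordered complexes whose components are the refinements `refineCochain θ φ_•` (B-p10's `refineComplexMap`, or any other
packaging), the induced maps on cohomology are multiplicative for the class-level cup ★ `OrderedCech.cupH`:
`Hⁿ(K)(x ⌣ y) = Hᵖ(F)(x) ⌣ Hᵠ(G)(y)` (`p + q = n`). [cite: StacksProject, Tag 01FP] [cite: StacksProject, Tag 01FM]
[cite: GortzWedhorn2023, (21.29)] [cite: Godement1958, II §6.6] -/
theorem homologyMap_cupH (hUa : ∀ s : Finset ι, s.Nonempty → IsAffineOpen (cechOpen U s))
    (hcov : ⨆ i, U i = ⊤) (hL : IsAffineLocalizing L) (hβ : IsNaturalPairing β) (hβ' : IsNaturalPairing β')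
    (hφ : ∀ (s' : Finset ι') (x : M.obj (s'.image θ)) (y : N.obj (s'.image θ)),
      (φP.app s').hom (β (s'.image θ) x y) = β' s' ((φM.app s').hom x) ((φN.app s').hom y))
    (F : sysComplex M ⟶ sysComplex M') (hF : ∀ (k : ℕ) (x : SysCochain M k), (F.f k).hom x = refineCochain θ φM k x)
    (G : sysComplex N ⟶ sysComplex N') (hG : ∀ (k : ℕ) (x : SysCochain N k), (G.f k).hom x = refineCochain θ φN k x)
    (K : sysComplex (sectionsSystem U L ρ) ⟶ sysComplex P')
    (hK : ∀ (k : ℕ) (x : SysCochain (sectionsSystem U L ρ) k), (K.f k).hom x = refineCochain θ φP k x)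
    (p q n : ℕ) (h : p + q = n) (x : (sysComplex M).homology (p : ℤ)) (y : (sysComplex N).homology (q : ℤ)) :
    (HomologicalComplex.homologyMap K n).hom (cupH β hβ p q n h x y) =
      cupH β' hβ' p q n h ((HomologicalComplex.homologyMap F p).hom x) ((HomologicalComplex.homologyMap G q).hom y) := by
  obtain ⟨z, rfl⟩ := homologyπ_surjective (sysComplex M) p x
  obtain ⟨w, rfl⟩ := homologyπ_surjective (sysComplex N) q y
  -- naturality of `π` and of `ι` (elementwise)
  have hπK := fun c => congrArg (fun f => f.hom c) (HomologicalComplex.homologyπ_naturality K (n : ℤ))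
  have hπF := congrArg (fun f => f.hom z) (HomologicalComplex.homologyπ_naturality F (p : ℤ))
  have hπG := congrArg (fun f => f.hom w) (HomologicalComplex.homologyπ_naturality G (q : ℤ))
  have hιK := fun c => congrArg (fun f => f.hom c) (HomologicalComplex.cyclesMap_i K (n : ℤ))
  have hιF := congrArg (fun f => f.hom z) (HomologicalComplex.cyclesMap_i F (p : ℤ))
  have hιG := congrArg (fun f => f.hom w) (HomologicalComplex.cyclesMap_i G (q : ℤ))
  simp only [ModuleCat.hom_comp, LinearMap.comp_apply] at hπK hπF hπG hιK hιF hιG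
  rw [cupH_π, hπK, hπF, hπG, cupH_π]
  -- the two underlying cochains are cocycles `a`, `b` pulled back
  set a : SysCochain M p := ((sysComplex M).iCycles p).hom z with ha_def
  set b : SysCochain N q := ((sysComplex N).iCycles q).hom w with hb_def
  have ha : sysD M p a = 0 := by
    have := congrArg (fun f => f.hom z) ((sysComplex M).iCycles_d (p : ℤ) (p + 1))
    rw [sysComplex_d] at this
    exact this
  have hb : sysD N q b = 0 := by
    have := congrArg (fun f => f.hom w) ((sysComplex N).iCycles_d (q : ℤ) (q + 1))
    rw [sysComplex_d] at this
    exact this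
  -- degree `0`: equal cocycles; positive degree: cocycles differing by a coboundary
  rcases Nat.eq_zero_or_eq_succ_pred n with hn | hn
  · subst hn
    have hp0 : p = 0 := by omega
    have hq0 : q = 0 := by omega
    subst hp0
    subst hq0
    congr 1
    apply cycles_ext
    rw [hιK, iCycles_cupCycles β hβ 0 0 0 h, iCycles_cupCycles β' hβ' 0 0 0 h, hιF, hιG, hK, hF, hG]
    exact Full.refineCochain_cup_zero β' θ φM φN φP hβ hβ' hφ a b
  · obtain ⟨m, rfl⟩ : ∃ m, n = m + 1 := ⟨n.pred, hn⟩
    obtain ⟨η, hη⟩ := refineCochain_cup_sub_eq_sysD U L ρ β β' θ φM φN φP hUa hcov hL hβ hβ' hφ h a b ha hb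
    refine homologyπ_eq_of_sub_eq_d (sysComplex P') _ _ (i' := (m : ℤ)) η ?_
    rw [hιK, iCycles_cupCycles β hβ p q (m + 1) h, iCycles_cupCycles β' hβ' p q (m + 1) h, hιF, hιG, hK, hF, hG, hη]
    have hd : (sysComplex P').d (m : ℤ) ((m + 1 : ℕ) : ℤ) = ModuleCat.ofHom (sysD P' m) := sysComplex_d P' m
    rw [hd]
    rfl

end Literature.AlgebraicGeometry.Modules

end
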